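import Summits.Ventures.LatticeQCDFlow.Exactness.FreeFieldHeatBathExact
import HarnessLib

/-!
# Adler's stochastic over-relaxation is exact for the free field on `ℝ^Λ`, for every `ω ∈ (0, 2)`

HONEST FRAMING: exact (Metropolis-corrected) sampling algorithms for lattice gauge theory;
figures of merit are autocorrelation/cost numbers at stated couplings and volumes; no
continuum-physics claim.  (SCALAR calibration rung S0-A: not a gauge result.)

Venture `LatticeQCDFlow` (cell pub-lqcd), topic `Exactness`; FANOUT row 2 (`s0-phi4`).  NEW WORK
of the cell (one Fubini swap on `ℝ × ℝ`, one on `ℝ^{n+1}`, and a completed square; over Mathlib);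
nothing is cited as a fact.  Printed counterparts, named only: Adler 1981 (Phys. Rev. D 23, 2901:
over-relaxed heat bath for multiquadratic actions), Whitmer 1984, Neal 1998 ("Suppressing random
walks … using ordered overrelaxation", §2: Adler's method leaves the Gaussian conditional
invariant), Fox–Parker 2017 (SOR splitting as a Gibbs-type sampler).

Relation to the tree.  Row 9's `Exactness/FibreLift.lean` proves, abstractly over Mathlib
kernels on a product `X × Y`, that fibrewise-reversible updates lift (`freezeSnd_isReversible`)
and that the conditional redraw `heatBathX` is reversible (`heatBath_isReversible`);
`Exactness/Overrelaxation.lean` treats the deterministic MICROCANONICAL reflection.  The companion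
`Exactness/FreeFieldHeatBathExact.lean` and this file are the CONCRETE free-field instances on
`Fin (n+1) → ℝ` for the explicit Gaussian kernels `siteUpdate J ω x` of
`Scoring/FreeFieldHeatBath.lean` (`ω = 1` there, `0 < ω < 2` here), in the integrated form
`∫ (P f) e^{−S} = ∫ f e^{−S}` that `Scoring/FreeFieldHeatBathSpectrum.lean` consumes; the
STOCHASTIC over-relaxation kernel (`ω ≠ 1`: neither a conditional redraw nor a deterministic
involution) is new in the tree.

## What is proved

* **`olr_density_symm`** — with `w = ω(2−ω)v`:
  `pdf(μ,v;t)·pdf((1−ω)t+ωμ, w; s) = pdf(μ,v;s)·pdf((1−ω)s+ωμ, w; t)` (Mathlib `gaussianPDFReal`;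
  the pair (current, proposed) is an exchangeable bivariate Gaussian — detailed balance in
  density form; the identity `ω(2−ω) + (1−ω)² = 1`).
* **`olr_gaussian_invariant`** — for `v ≠ 0`, `w = ω(2−ω)v ≠ 0` and every bounded measurable `g`:
  `∫ (∫ g dN((1−ω)t+ωμ, w)) pdf(μ,v;t) dt = ∫ g pdf(μ,v;·)`: the AR(1) kernel
  `t ↦ (1−ω)t + ωμ + √w ξ` leaves `N(μ, v)` invariant (symmetry + Fubini on `ℝ × ℝ`, the joint
  integrand being `|g| ≤ B` times a product of densities of total mass one).
* `siteUpdate_omega_eq` / `siteUpdate_omega_update` (the kernel along the coordinate line reads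
  the current value only through the AR(1) mean), `abs_siteUpdate_omega_le`,
  `measurable_siteUpdate_omega` (`J_{xx} > 0`, `0 < ω < 2`).
* **`overrelaxation_site_exact`** — `S = ΣφJφ` coercive, `J_{xx} > 0`, `0 < ω < 2`, `f` bounded
  measurable: `∫ (P_x^ω f) e^{−S} dφ = ∫ f e^{−S} dφ` (split off the `x`-coordinate with
  `integral_eq_integral_insertNth`; on the line the weight is `Z_x · pdf(μ_x, 1/(2J_{xx}); ·)` by
  `condDensity_mul_siteZ`, and `olr_gaussian_invariant` closes); `overrelaxation_site_exact_expect`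
  `⟨P_x^ω f⟩ = ⟨f⟩`; **`overrelaxation_scan_exact_expect`** `⟨P^ω f⟩ = ⟨f⟩` for the random scan;
  **`overrelaxation_scan_exact_shift`** — the engine instance `J = −Δ_lat + m²`, `m² > 0`, shifts
  fixing no site: unconditional.

With `Scoring/FreeFieldHeatBathSpectrum.lean`: the `ω`-chain started in the free-field law is
stationary, every Fourier mode is an exact AR(1) series with coefficient
`1 − ω(κ + m²)/(V(2d + m²))`, and `τ_int/V = (2d + m²)/(ω(κ + m²)) − 1/(2V)` sweeps are the
equilibrium autocorrelation times — for EVERY `ω ∈ (0, 2)`.  NOT CLAIMED: the endpoint `ω = 2`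
(deterministic reflection `φ_x ↦ 2μ_x − φ_x`, exact but not ergodic — `Overrelaxation.lean`'s
setting); ordered sweeps; `λ > 0` (Adler's method needs Gaussian conditionals; for φ⁴ the engine
uses Metropolis); convergence.
-/

namespace Summit.Ventures.LatticeQCDFlow.Exactness

open Real MeasureTheory ProbabilityTheory Finset Filter
open Summit.Ventures.LatticeQCDFlow.Scoring

variable {n : ℕ}

/-! ## The one-dimensional fact: the AR(1) kernel is reversible for its Gaussian -/

/-- **Detailed balance of the over-relaxation kernel, density form.**  With `w = ω(2−ω)v` the
two-point density `pdf(μ,v;t) · pdf((1−ω)t+ωμ, w; s)` is SYMMETRIC in `(t, s)`: the pair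
(current, proposed) is an exchangeable bivariate Gaussian. -/
theorem olr_density_symm (μ : ℝ) {v w : NNReal} (ω : ℝ) (hw : (w : ℝ) = ω * (2 - ω) * v)
    (hv : (v : ℝ) ≠ 0) (hw0 : (w : ℝ) ≠ 0) (t s : ℝ) :
    gaussianPDFReal μ v t * gaussianPDFReal ((1 - ω) * t + ω * μ) w s
      = gaussianPDFReal μ v s * gaussianPDFReal ((1 - ω) * s + ω * μ) w t := by
  simp only [gaussianPDFReal_def]
  have key : -(t - μ) ^ 2 / (2 * (v : ℝ)) + -(s - ((1 - ω) * t + ω * μ)) ^ 2 / (2 * (w : ℝ))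
      = -(s - μ) ^ 2 / (2 * (v : ℝ)) + -(t - ((1 - ω) * s + ω * μ)) ^ 2 / (2 * (w : ℝ)) := by
    rw [div_add_div _ _ (by positivity) (by positivity), div_add_div _ _ (by positivity) (by positivity),
      hw]
    congr 1
    ring
  rw [mul_mul_mul_comm, ← Real.exp_add, key, Real.exp_add, mul_mul_mul_comm]

/-- **The AR(1) / over-relaxation kernel leaves its Gaussian invariant** (integrated against a
bounded measurable test function): for `v ≠ 0`, `0 < ω < 2`, `w = ω(2−ω)v`,
`∫ (∫ g dN((1−ω)t+ωμ, w)) pdf(μ,v;t) dt = ∫ g(s) pdf(μ,v;s) ds`. -/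
theorem olr_gaussian_invariant (μ : ℝ) {v w : NNReal} {ω : ℝ} (hw : (w : ℝ) = ω * (2 - ω) * v)
    (hv : v ≠ 0) (hw0 : w ≠ 0) {g : ℝ → ℝ} (hgm : Measurable g) {B : ℝ} (hgb : ∀ s, |g s| ≤ B) :
    ∫ t, (∫ s, g s ∂gaussianReal ((1 - ω) * t + ω * μ) w) * gaussianPDFReal μ v t
      = ∫ s, g s * gaussianPDFReal μ v s := by
  have hv' : (v : ℝ) ≠ 0 := by exact_mod_cast hv
  have hw' : (w : ℝ) ≠ 0 := by exact_mod_cast hw0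
  -- density form of the inner integral, and pull the outer density inside
  have h1 : ∀ t, (∫ s, g s ∂gaussianReal ((1 - ω) * t + ω * μ) w) * gaussianPDFReal μ v t
      = ∫ s, g s * gaussianPDFReal μ v s * gaussianPDFReal ((1 - ω) * s + ω * μ) w t := by
    intro t
    rw [integral_gaussianReal_eq_integral_smul hw0, ← integral_mul_const]
    refine integral_congr_ae (Eventually.of_forall fun s => ?_)
    simp only [smul_eq_mul]
    rw [mul_assoc (g s), ← olr_density_symm μ ω hw hv' hw' t s]
    ring
  simp only [h1]
  -- Fubini: the integrand `(s, t) ↦ g s · pdf(μ,v;s) · pdf(m s, w; t)` is integrable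
  set F : ℝ → ℝ → ℝ :=
    fun s t => g s * gaussianPDFReal μ v s * gaussianPDFReal ((1 - ω) * s + ω * μ) w t with hF
  have hFm : Measurable (Function.uncurry F) := by
    have hc : Continuous fun p : ℝ × ℝ =>
        gaussianPDFReal μ v p.1 * gaussianPDFReal ((1 - ω) * p.1 + ω * μ) w p.2 := by
      simp only [gaussianPDFReal_def]
      fun_prop
    have e : Function.uncurry F
        = fun p : ℝ × ℝ => g p.1 * (gaussianPDFReal μ v p.1
            * gaussianPDFReal ((1 - ω) * p.1 + ω * μ) w p.2) := by
      funext p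
      simp only [Function.uncurry, hF]
      ring
    rw [e]
    exact (hgm.comp measurable_fst).mul hc.measurable
  have hB0 : 0 ≤ B := le_trans (abs_nonneg _) (hgb 0)
  have hFint : Integrable (Function.uncurry F) ((volume : Measure ℝ).prod volume) := by
    rw [integrable_prod_iff hFm.aestronglyMeasurable]
    constructor
    · refine Eventually.of_forall fun s => ?_
      simp only [Function.uncurry_apply_pair, hF]
      exact (integrable_gaussianPDFReal _ _).const_mul _
    · simp only [Function.uncurry_apply_pair]
      have e : (fun s => ∫ t, ‖F s t‖)
          = fun s => |g s| * gaussianPDFReal μ v s := by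
        funext s
        simp only [hF, Real.norm_eq_abs]
        have habs : ∀ t, |g s * gaussianPDFReal μ v s * gaussianPDFReal ((1 - ω) * s + ω * μ) w t|
            = |g s| * gaussianPDFReal μ v s * gaussianPDFReal ((1 - ω) * s + ω * μ) w t := by
          intro t
          rw [abs_mul, abs_mul, abs_of_nonneg (gaussianPDFReal_nonneg _ _ _),
            abs_of_nonneg (gaussianPDFReal_nonneg _ _ _)]
        simp only [habs]
        rw [integral_const_mul, integral_gaussianPDFReal_eq_one _ hw0, mul_one]
      rw [e]
      refine Integrable.mono' ((integrable_gaussianPDFReal μ v).const_mul B)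
        ((hgm.abs.aestronglyMeasurable).mul
          (stronglyMeasurable_gaussianPDFReal μ v).aestronglyMeasurable)
        (Eventually.of_forall fun s => ?_)
      rw [Real.norm_eq_abs, abs_mul, abs_abs, abs_of_nonneg (gaussianPDFReal_nonneg _ _ _)]
      exact mul_le_mul_of_nonneg_right (hgb s) (gaussianPDFReal_nonneg _ _ _)
  have hswap := integral_integral_swap hFint
  -- `∫ t ∫ s F s t = ∫ s ∫ t F s t`
  rw [← hswap]
  refine integral_congr_ae (Eventually.of_forall fun s => ?_)
  simp only [hF]
  rw [integral_const_mul, integral_gaussianPDFReal_eq_one _ hw0, mul_one]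

/-! ## The over-relaxed kernel on `ℝ^Λ` -/

/-- The `ω`-kernel written with the conditional mean: from `φ`, the new `φ_x` is drawn from
`N((1−ω)φ_x + ω μ_x(φ), ω(2−ω)/(2J_{xx}))`. -/
theorem siteUpdate_omega_eq (J : Fin (n + 1) → Fin (n + 1) → ℝ) (ω : ℝ) (x : Fin (n + 1))
    (f : (Fin (n + 1) → ℝ) → ℝ) (φ : Fin (n + 1) → ℝ) :
    siteUpdate J ω x f φ
      = ∫ s, f (Function.update φ x s)
          ∂gaussianReal ((1 - ω) * φ x + ω * hbMean J φ x)
            (Real.toNNReal (ω * (2 - ω) / (2 * J x x))) := by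
  have h1 : φ x - ω * (latticePhi4Force J 0 φ x / (2 * J x x))
      = (1 - ω) * φ x + ω * hbMean J φ x := by
    unfold hbMean; ring
  rw [siteUpdate, h1]

/-- Along the coordinate line of `x` the kernel reads the current value `t` only through the
AR(1) mean `(1−ω)t + ωμ_x(ψ)`. -/
theorem siteUpdate_omega_update (J : Fin (n + 1) → Fin (n + 1) → ℝ) (ω : ℝ) (x : Fin (n + 1))
    (hJ : J x x ≠ 0) (f : (Fin (n + 1) → ℝ) → ℝ) (ψ : Fin (n + 1) → ℝ) (t : ℝ) :
    siteUpdate J ω x f (Function.update ψ x t)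
      = ∫ s, f (Function.update ψ x s)
          ∂gaussianReal ((1 - ω) * t + ω * hbMean J ψ x)
            (Real.toNNReal (ω * (2 - ω) / (2 * J x x))) := by
  rw [siteUpdate_omega_eq, hbMean_update J ψ x hJ t, Function.update_self]
  simp only [Function.update_idem]

/-- The over-relaxed kernel of a bounded observable is bounded by the same constant. -/
theorem abs_siteUpdate_omega_le (J : Fin (n + 1) → Fin (n + 1) → ℝ) (ω : ℝ) (x : Fin (n + 1))
    {f : (Fin (n + 1) → ℝ) → ℝ} {B : ℝ} (hfb : ∀ φ, |f φ| ≤ B) (φ : Fin (n + 1) → ℝ) :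
    |siteUpdate J ω x f φ| ≤ B := by
  rw [siteUpdate_omega_eq]
  have h := norm_integral_le_of_norm_le_const
    (μ := gaussianReal ((1 - ω) * φ x + ω * hbMean J φ x)
      (Real.toNNReal (ω * (2 - ω) / (2 * J x x))))
    (f := fun s => f (Function.update φ x s)) (C := B)
    (Eventually.of_forall fun s => by rw [Real.norm_eq_abs]; exact hfb _)
  rw [probReal_univ, mul_one, Real.norm_eq_abs] at h
  exact h

/-- Measurability of the over-relaxed kernel of a measurable observable (`J_{xx} > 0`,
`0 < ω < 2`). -/
theorem measurable_siteUpdate_omega (J : Fin (n + 1) → Fin (n + 1) → ℝ) {ω : ℝ} (hω0 : 0 < ω)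
    (hω2 : ω < 2) (x : Fin (n + 1)) (hJ : 0 < J x x) {f : (Fin (n + 1) → ℝ) → ℝ}
    (hfm : Measurable f) : StronglyMeasurable (siteUpdate J ω x f) := by
  set w : NNReal := Real.toNNReal (ω * (2 - ω) / (2 * J x x)) with hw
  have hw0 : w ≠ 0 := by
    rw [hw]
    have : 0 < ω * (2 - ω) / (2 * J x x) := by
      have : 0 < 2 - ω := by linarith
      positivity
    exact (Real.toNNReal_pos.mpr this).ne'
  have hdens : siteUpdate J ω x f
      = fun φ => ∫ s, gaussianPDFReal ((1 - ω) * φ x + ω * hbMean J φ x) w s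
          * f (Function.update φ x s) := by
    funext φ
    rw [siteUpdate_omega_eq, integral_gaussianReal_eq_integral_smul hw0]
    rfl
  rw [hdens]
  have hmean : Continuous fun φ : Fin (n + 1) → ℝ => (1 - ω) * φ x + ω * hbMean J φ x := by
    unfold hbMean
    exact (continuous_const.mul (continuous_apply x)).add (continuous_const.mul
      ((continuous_apply x).sub ((continuous_latticePhi4Force J 0 x).div_const _)))
  have hpdf : Continuous fun p : (Fin (n + 1) → ℝ) × ℝ =>
      gaussianPDFReal ((1 - ω) * p.1 x + ω * hbMean J p.1 x) w p.2 := by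
    simp only [gaussianPDFReal_def]
    have h1 : Continuous fun p : (Fin (n + 1) → ℝ) × ℝ => (1 - ω) * p.1 x + ω * hbMean J p.1 x :=
      hmean.comp continuous_fst
    fun_prop
  have hF : Measurable fun p : (Fin (n + 1) → ℝ) × ℝ =>
      gaussianPDFReal ((1 - ω) * p.1 x + ω * hbMean J p.1 x) w p.2
        * f (Function.update p.1 x p.2) :=
    hpdf.measurable.mul (hfm.comp measurable_update')
  exact hF.stronglyMeasurable.integral_prod_right'

/-- **ADLER'S OVER-RELAXATION IS EXACT FOR THE FREE FIELD (one site).**  Let `S = Σ φJφ` be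
coercive with `J_{xx} > 0`, and `0 < ω < 2`.  For every bounded measurable observable `f`,
`∫ (P_x^ω f) e^{−S} dφ = ∫ f e^{−S} dφ`: drawing the new `φ_x` from
`N((1−ω)φ_x + ωμ_x(φ), ω(2−ω)/(2J_{xx}))` leaves the Gibbs law invariant (`ω = 1`: the heat bath
of `FreeFieldHeatBathExact.lean`; `ω → 2`: the microcanonical reflection `φ_x ↦ 2μ_x − φ_x`). -/
theorem overrelaxation_site_exact {J : Fin (n + 1) → Fin (n + 1) → ℝ} {ε K : ℝ} (hε : 0 < ε)
    (hS : ∀ φ : Fin (n + 1) → ℝ, ε * ∑ w, φ w ^ 2 - K ≤ latticePhi4Action J 0 φ)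
    (x : Fin (n + 1)) (hJ : 0 < J x x) {ω : ℝ} (hω0 : 0 < ω) (hω2 : ω < 2)
    {f : (Fin (n + 1) → ℝ) → ℝ} (hfm : Measurable f) {B : ℝ} (hfb : ∀ φ, |f φ| ≤ B) :
    ∫ φ, siteUpdate J ω x f φ * gibbsWeight J 0 φ = ∫ φ, f φ * gibbsWeight J 0 φ := by
  have hw_int : Integrable (gibbsWeight J 0) := integrable_gibbsWeight_of_coercive hε hS
  have hG1 : Integrable (fun φ => f φ * gibbsWeight J 0 φ) := by
    refine Integrable.mono' (hw_int.const_mul B) (hfm.aestronglyMeasurable.mul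
      (continuous_gibbsWeight J 0).aestronglyMeasurable) (Eventually.of_forall fun φ => ?_)
    rw [Real.norm_eq_abs, abs_mul, abs_of_pos (gibbsWeight_pos J 0 φ)]
    exact mul_le_mul_of_nonneg_right (hfb φ) (gibbsWeight_pos J 0 φ).le
  have hG2 : Integrable (fun φ => siteUpdate J ω x f φ * gibbsWeight J 0 φ) := by
    refine Integrable.mono' (hw_int.const_mul B)
      ((measurable_siteUpdate_omega J hω0 hω2 x hJ hfm).aestronglyMeasurable.mul
        (continuous_gibbsWeight J 0).aestronglyMeasurable) (Eventually.of_forall fun φ => ?_)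
    rw [Real.norm_eq_abs, abs_mul, abs_of_pos (gibbsWeight_pos J 0 φ)]
    exact mul_le_mul_of_nonneg_right (abs_siteUpdate_omega_le J ω x hfb φ)
      (gibbsWeight_pos J 0 φ).le
  rw [integral_eq_integral_insertNth x hG2, integral_eq_integral_insertNth x hG1]
  refine integral_congr_ae (Eventually.of_forall fun x' => ?_)
  set ψ : Fin (n + 1) → ℝ := Fin.insertNth x (0 : ℝ) x' with hψ
  have hins : ∀ t : ℝ, (Fin.insertNth x t x' : Fin (n + 1) → ℝ) = Function.update ψ x t :=
    fun t => insertNth_eq_update x t x'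
  simp only [hins]
  -- the variances
  set v : NNReal := Real.toNNReal (1 / (2 * J x x)) with hv
  set w : NNReal := Real.toNNReal (ω * (2 - ω) / (2 * J x x)) with hw
  have hv0 : v ≠ 0 := by
    rw [hv]
    have : 0 < 1 / (2 * J x x) := by positivity
    exact (Real.toNNReal_pos.mpr this).ne'
  have h2ω : 0 < 2 - ω := by linarith
  have hw0 : w ≠ 0 := by
    rw [hw]
    have : 0 < ω * (2 - ω) / (2 * J x x) := by positivity
    exact (Real.toNNReal_pos.mpr this).ne'
  have hvw : ((w : NNReal) : ℝ) = ω * (2 - ω) * (v : ℝ) := by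
    rw [hw, hv, Real.coe_toNNReal _ (by positivity), Real.coe_toNNReal _ (by positivity)]
    ring
  -- the weight along the line is `Z · pdf(μ, v; ·)`
  set μx := hbMean J ψ x with hμ
  set Z := ∫ u, gibbsWeight J 0 (Function.update ψ x u) with hZ
  have hwgt : ∀ t, gibbsWeight J 0 (Function.update ψ x t) = Z * gaussianPDFReal μx v t := by
    intro t
    rw [← condDensity_mul_siteZ J x hJ ψ t, mul_comm]
  -- the test function along the line
  have hgm : Measurable fun s => f (Function.update ψ x s) :=
    hfm.comp (measurable_update' (a := x) |>.comp (measurable_const.prodMk measurable_id))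
  simp only [siteUpdate_omega_update J ω x hJ.ne' f ψ, hwgt]
  rw [← hw, ← hμ]
  have el : ∀ t, (∫ s, f (Function.update ψ x s) ∂gaussianReal ((1 - ω) * t + ω * μx) w)
        * (Z * gaussianPDFReal μx v t)
      = Z * ((∫ s, f (Function.update ψ x s) ∂gaussianReal ((1 - ω) * t + ω * μx) w)
        * gaussianPDFReal μx v t) := fun t => by ring
  have er : ∀ s, f (Function.update ψ x s) * (Z * gaussianPDFReal μx v s)
      = Z * (f (Function.update ψ x s) * gaussianPDFReal μx v s) := fun s => by ring
  simp only [el, er]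
  rw [integral_const_mul, integral_const_mul,
    olr_gaussian_invariant μx hvw hv0 hw0 hgm (fun s => hfb _)]

/-- **Normalised form**: `⟨P_x^ω f⟩ = ⟨f⟩`. -/
theorem overrelaxation_site_exact_expect {J : Fin (n + 1) → Fin (n + 1) → ℝ} {ε K : ℝ}
    (hε : 0 < ε) (hS : ∀ φ : Fin (n + 1) → ℝ, ε * ∑ w, φ w ^ 2 - K ≤ latticePhi4Action J 0 φ)
    (x : Fin (n + 1)) (hJ : 0 < J x x) {ω : ℝ} (hω0 : 0 < ω) (hω2 : ω < 2)
    {f : (Fin (n + 1) → ℝ) → ℝ} (hfm : Measurable f) {B : ℝ} (hfb : ∀ φ, |f φ| ≤ B) :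
    gibbsExpect J 0 (siteUpdate J ω x f) = gibbsExpect J 0 f := by
  unfold gibbsExpect
  rw [overrelaxation_site_exact hε hS x hJ hω0 hω2 hfm hfb]

/-- **The random-scan over-relaxed sweep is exact**: `⟨P^ω f⟩ = ⟨f⟩` (all `J_{xx} > 0`,
`0 < ω < 2`). -/
theorem overrelaxation_scan_exact_expect {J : Fin (n + 1) → Fin (n + 1) → ℝ} {ε K : ℝ}
    (hε : 0 < ε) (hS : ∀ φ : Fin (n + 1) → ℝ, ε * ∑ w, φ w ^ 2 - K ≤ latticePhi4Action J 0 φ)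
    (hJ : ∀ x, 0 < J x x) {ω : ℝ} (hω0 : 0 < ω) (hω2 : ω < 2)
    {f : (Fin (n + 1) → ℝ) → ℝ} (hfm : Measurable f) {B : ℝ} (hfb : ∀ φ, |f φ| ≤ B) :
    gibbsExpect J 0 (scanUpdate J ω f) = gibbsExpect J 0 f := by
  have hw_int : Integrable (gibbsWeight J 0) := integrable_gibbsWeight_of_coercive hε hS
  have hI : ∀ x, Integrable (fun φ => siteUpdate J ω x f φ * gibbsWeight J 0 φ) := by
    intro x
    refine Integrable.mono' (hw_int.const_mul B)
      ((measurable_siteUpdate_omega J hω0 hω2 x (hJ x) hfm).aestronglyMeasurable.mul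
        (continuous_gibbsWeight J 0).aestronglyMeasurable) (Eventually.of_forall fun φ => ?_)
    rw [Real.norm_eq_abs, abs_mul, abs_of_pos (gibbsWeight_pos J 0 φ)]
    exact mul_le_mul_of_nonneg_right (abs_siteUpdate_omega_le J ω x hfb φ)
      (gibbsWeight_pos J 0 φ).le
  unfold scanUpdate
  rw [gibbsExpect_const_mul, gibbsExpect_sum J 0 Finset.univ (fun x _ => hI x)]
  simp only [overrelaxation_site_exact_expect hε hS _ (hJ _) hω0 hω2 hfm hfb, Finset.sum_const,
    Finset.card_univ, nsmul_eq_mul, Fintype.card_fin]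
  have h : ((n + 1 : ℕ) : ℝ) ≠ 0 := by positivity
  rw [← mul_assoc, inv_mul_cancel₀ h, one_mul]

/-- **The engine instance**: for the free `phi4_2d` action (`J = −Δ_lat + m²`, shifts fixing no
site, `m² > 0`) and every `ω ∈ (0, 2)`, the random-scan over-relaxed heat bath leaves `e^{−S}/Z`
invariant. -/
theorem overrelaxation_scan_exact_shift {ι : Type*} [Fintype ι]
    (σ : ι → Equiv.Perm (Fin (n + 1))) {m2 : ℝ} (hm2 : 0 < m2) (hσ : ∀ μ x, σ μ x ≠ x)
    {ω : ℝ} (hω0 : 0 < ω) (hω2 : ω < 2) {f : (Fin (n + 1) → ℝ) → ℝ} (hfm : Measurable f)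
    {B : ℝ} (hfb : ∀ φ, |f φ| ≤ B) :
    gibbsExpect (shiftCoupling σ m2) 0 (scanUpdate (shiftCoupling σ m2) ω f)
      = gibbsExpect (shiftCoupling σ m2) 0 f := by
  have hS := shiftCoupling_coercive_of_pos_mass σ (m2 := m2) le_rfl
  have hJ : ∀ x, 0 < shiftCoupling σ m2 x x := by
    intro x
    rw [shiftCoupling_diag σ m2 x (fun μ => hσ μ x)]
    positivity
  exact overrelaxation_scan_exact_expect hm2 hS hJ hω0 hω2 hfm hfb

end Summit.Ventures.LatticeQCDFlow.Exactness
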